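import Summits.CriticalPhenomena.PercolationContinuityZ3.Theorems.PercNearOneGluingNoHeavyLowerTailMajorityGluingQCertSound
import Summits.CriticalPhenomena.PercolationContinuityZ3.Theorems.PercNearOneGluingNoHeavyLowerTailMajorityGluingQCertLawK
import Summits.CriticalPhenomena.PercolationContinuityZ3.Theorems.PercNearOneGluingNoHeavyLowerTailMajorityGluingEightCert
import HarnessLib

/-!
# «At least `h` of `k` relays cut» from ANY passing certificate: the generic counting theorem of the certificate machine (lane prim-rate, constants-miner 1, gen 34; CANDIDATES §GEN-34 R325, NEXT-g35)

Support file for the closed crux `NoHeavyLowerTail` (stmt-CriticalPhenomena-4575), majority-gluing line.  `…MajorityGluingEightCert` proved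
`fourOfSix_of_check_count` for six relays; here the same assembly for `k` relays and threshold `c.h` over the dictionary `…QCertLawK`:
every well-formed row holds at the law (`row_lawvK` = `BergKahn.bergKahn_thm_1_2` on the images), a `k`-set has an enumeration sorted along any real key
(`exists_sorted_enumK`), and **`cut_of_check_count`**: if `c.check = true`, `c.m = k`, `c.fam = 1`, then for every finite weighted graph, hub `a₀`, `k`-set `T`
and `δ ≥ 0` bounding the cut probabilities `μ(v ↮ a₀)` on `T`:  `cD·μ(c.h ≤ #{v ∈ T : v ↮ a₀}) ≤ cN·δ`.  A certificate for `(7,5)` or `R_5 = (8,5)` thus lands as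
data + one `decide +kernel` + an instantiation of this theorem.  No sorries. [cite: VandenbergKahn2001, Thm 1.2 (p. 123)]
-/

noncomputable section

namespace Summit.CriticalPhenomena.PercolationContinuityZ3.Theorems

open MeasureTheory Set
open Literature.Probability.LatticeModels (prodBernoulli)
open Literature.Probability.Percolation
open scoped Classical

namespace HubOnly
namespace QCert

variable {n k : ℕ}

/-! ### A sorted enumeration of `k` relays -/

/-- For `|T| = k` and any real key `g`, an injective enumeration of `T` along which `g` is monotone. [folklore] -/
theorem exists_sorted_enumK (T : Finset (Fin n)) (hT : T.card = k) (g : Fin n → ℝ) :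
    ∃ t : Fin k → Fin n, Function.Injective t ∧ T = Finset.univ.image t ∧ Monotone (g ∘ t) := by
  set e := T.orderIsoOfFin hT with he
  set σ := Tuple.sort (fun i => g (e i)) with hσ
  refine ⟨fun i => (e (σ i) : Fin n), ?_, ?_, ?_⟩
  · intro i j hij
    exact σ.injective (e.injective (Subtype.val_injective hij))
  · ext v
    simp only [Finset.mem_image, Finset.mem_univ, true_and]
    constructor
    · intro hv
      refine ⟨σ.symm (e.symm ⟨v, hv⟩), ?_⟩
      simp
    · rintro ⟨i, rfl⟩
      exact (e (σ i)).2
  · exact Tuple.monotone_sort (fun i => g (e i))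

/-! ### The rows and the theorem -/

section AnyK

variable (c : Cert) (hm : c.m = k) (hfam : c.fam = 1)
include hm

/-- **Every well-formed row holds at the law** (van den Berg–Kahn's Theorem 1.2 rooted at the hub, for the images of its four sets). [cite: VandenbergKahn2001, Thm 1.2 (p. 123)] -/
theorem row_lawvK (w : Sym2 (Fin n) → unitInterval) (a₀ : Fin n) (t : Fin k → Fin n) (ht : Function.Injective t) (δ : ℝ)
    (r : RowE) (hr : c.rowOK r = true) :
    linv (2 ^ k + 1) (fun i => Cert.bi (tb r.m1 i)) (lawvK w a₀ t δ) * linv (2 ^ k + 1) (fun i => Cert.bi (tb r.m2 i)) (lawvK w a₀ t δ) ≤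
      linv (2 ^ k + 1) (fun i => Cert.bi (tb r.m3 i)) (lawvK w a₀ t δ) * linv (2 ^ k + 1) (fun i => Cert.bi (tb r.m4 i)) (lawvK w a₀ t δ) := by
  unfold Cert.rowOK at hr
  simp only [Bool.and_eq_true, decide_eq_true_eq, hm] at hr
  obtain ⟨⟨⟨⟨⟨⟨⟨_, hX⟩, _⟩, hY⟩, h1⟩, h2⟩, h3⟩, h4⟩ := hr
  have hXY : r.X &&& r.Y < 2 ^ k := lt_of_le_of_lt Nat.and_le_left hX
  have hXuY : r.X ||| r.Y < 2 ^ k := Nat.or_lt_two_pow hX hY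
  rw [linv_lawvK _ _ _ _ _ (tb_D_of_maskOKK c hm _ _ _ h1), linv_lawvK _ _ _ _ _ (tb_D_of_maskOKK c hm _ _ _ h2),
    linv_lawvK _ _ _ _ _ (tb_D_of_maskOKK c hm _ _ _ h3), linv_lawvK _ _ _ _ _ (tb_D_of_maskOKK c hm _ _ _ h4),
    setOf_cylK c hm a₀ t _ _ _ hX h1, setOf_cylK c hm a₀ t _ _ _ hY h2, setOf_cylK c hm a₀ t _ _ _ hXY h3,
    setOf_cylK c hm a₀ t _ _ _ hXuY h4, imK_or, imK_and t ht, imK_or, imK_zero, setOf_att_empty, univ_inter]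
  exact BergKahn.bergKahn_thm_1_2 w a₀ (imK t r.A) (imK t r.B) (imK t r.X) (imK t r.Y)

include hfam in
/-- **«At least `h` of `k` cut» along a sorted enumeration, for ANY passing certificate of case family `1`:** `cD·μ(c.h ≤ #cut T) ≤ cN·δ`.
[cite: VandenbergKahn2001, Thm 1.2 (p. 123)] -/
theorem cut_of_check (hc : c.check = true) (w : Sym2 (Fin n) → unitInterval) (a₀ : Fin n) (t : Fin k → Fin n)
    (ht : Function.Injective t) (T : Finset (Fin n)) (hT : T = Finset.univ.image t)
    (hmono : Monotone fun x : Fin k => (prodBernoulli w).real ((openConn a₀ (t x) : Set (BondConfig (Fin n))) ∩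
      {ω : BondConfig (Fin n) | c.h ≤ (T.filter fun x => ω ∉ (openConn a₀ x : Set (BondConfig (Fin n)))).card}))
    (δ : ℝ) (hδ0 : 0 ≤ δ) (hδ : ∀ x : Fin k, (prodBernoulli w).real (openConn a₀ (t x) : Set (BondConfig (Fin n)))ᶜ ≤ δ) :
    (c.cD : ℝ) * (prodBernoulli w).real
        {ω : BondConfig (Fin n) | c.h ≤ (T.filter fun x => ω ∉ (openConn a₀ x : Set (BondConfig (Fin n)))).card} ≤ c.cN * δ := by
  have hNV : c.NV = 2 ^ k + 1 := by rw [Cert.NV, hm]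
  have hD : c.D = 2 ^ k := by rw [Cert.D, hm]
  have hv : ∀ i, 0 ≤ lawvK w a₀ t δ i := lawvK_nonneg w a₀ t δ hδ0
  have hWQ : c.checkW = true ∧ c.checkQ 0 c.NV = true := by
    unfold Cert.check at hc
    simpa only [Bool.and_eq_true] using hc
  obtain ⟨_, _, _, _, hrows⟩ := c.checkW_spec hWQ.1
  have hsound := c.sound hWQ.1 hWQ.2 (lawvK w a₀ t δ) hv
    (by
      intro x hx
      rw [hm] at hx
      rw [hNV, hD, lawvK_D, linv_lawvK _ _ _ _ _ (margMemK_D c hm x), setOf_margMemK c hm a₀ t ⟨x, hx⟩]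
      exact hδ ⟨x, hx⟩)
    (by
      intro x hx
      rw [hm] at hx
      rw [hNV, linv_lawvK _ _ _ _ _ (eMemK_D c hm hfam x), linv_lawvK _ _ _ _ _ (eMemK_D c hm hfam (x + 1)),
        setOf_eMemK c hm hfam a₀ t ht T hT ⟨x, by omega⟩, setOf_eMemK c hm hfam a₀ t ht T hT ⟨x + 1, hx⟩]
      exact hmono (Fin.mk_le_mk.2 (by omega)))
    (by
      intro ch hch r hr
      rw [hNV]
      exact row_lawvK c hm w a₀ t ht δ r (hrows ch hch r hr))
  rw [hNV, hD, lawvK_D, linv_lawvK _ _ _ _ _ (tMemK_D c hm), setOf_tMemK c hm a₀ t ht T hT] at hsound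
  exact hsound

include hfam in
/-- **«AT LEAST `h` OF `k` RELAYS CUT» FOR ANY PASSING CERTIFICATE, counting form** (orientation `v ↮ a₀`; `|T| = k`; `δ ≥ 0` bounds the `k` cut probabilities):
`cD·μ(c.h ≤ #{v ∈ T : v ↮ a₀}) ≤ cN·δ`. [cite: VandenbergKahn2001, Thm 1.2 (p. 123)] -/
theorem cut_of_check_count (hc : c.check = true) (w : Sym2 (Fin n) → unitInterval) (a₀ : Fin n) (T : Finset (Fin n))
    (hT : T.card = k) (δ : ℝ) (hδ0 : 0 ≤ δ) (hδ : ∀ v ∈ T, (prodBernoulli w).real (openConn v a₀ : Set (BondConfig (Fin n)))ᶜ ≤ δ) :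
    (c.cD : ℝ) * (prodBernoulli w).real {ω : BondConfig (Fin n) | c.h ≤ (T.filter fun v => ω ∉ openConn v a₀).card} ≤ c.cN * δ := by
  have hδ' : ∀ x ∈ T, (prodBernoulli w).real (openConn a₀ x : Set (BondConfig (Fin n)))ᶜ ≤ δ := by
    intro x hx; rw [knThm2_openConn_comm]; exact hδ x hx
  have hset : {ω : BondConfig (Fin n) | c.h ≤ (T.filter fun v => ω ∉ openConn v a₀).card} =
      {ω : BondConfig (Fin n) | c.h ≤ (T.filter (fun x => ω ∉ (openConn a₀ x : Set (BondConfig (Fin n))))).card} := by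
    ext ω
    simp only [mem_setOf_eq]
    rw [Finset.filter_congr (fun v _ => by rw [knThm2_openConn_comm v a₀])]
  rw [hset]
  obtain ⟨t, ht, hTt, hmono⟩ := exists_sorted_enumK T hT (fun v => (prodBernoulli w).real
    ((openConn a₀ v : Set (BondConfig (Fin n))) ∩
      {ω : BondConfig (Fin n) | c.h ≤ (T.filter fun x => ω ∉ (openConn a₀ x : Set (BondConfig (Fin n)))).card}))
  exact cut_of_check c hm hfam hc w a₀ t ht T hTt hmono δ hδ0 fun x =>
    hδ' (t x) (by rw [hTt]; exact Finset.mem_image_of_mem _ (Finset.mem_univ _))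

end AnyK

end QCert
end HubOnly

end Summit.CriticalPhenomena.PercolationContinuityZ3.Theorems

end
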